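import Summits.KontsevichZagierPeriods.Zeta5Search.Certificates.PolyReflect3
import HarnessLib

/-!
# Formal linear combinations of opaque symbols and fraction-free elimination (cell `pub-zeta5`, certifier `cert-2`)

HONEST FRAMING: systematic search; no irrationality claim unless certified.

OUR infrastructure (Summit side), the LINEAR layer over `Certificates/PolyReflect3`: a module certificate (brown9 levels 2–3,
ttrl2 lane `zeta5-calc`, VIM.md §7) is an identity `Σ_X C_X·T[X] = 0` among finitely many opaque symbol values `T[X]`
(instances of the inner block `T(n;p,q)`) that follows from RELATION INSTANCES `Σ_Y a_{r,Y}·T[Y] = 0` (cert-1's level-1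
theorems at shifted arguments). Here:
* `LC = List Poly3`: the formal combination `Σ_i E[i]·T_i` (`lcEval` against `T : ℕ → ℚ`), `lcAdd`, `lcSmul`, `lcGet`,
  `lcSingle`, `rel3` (three-point relation instance), `lcIsZero`, `lcTrim`;
* FRACTION-FREE ELIMINATION `elimStep a R s E = a•E − E[s]•R` (with `a = R[s]` this kills `T_s`), `elimRun` over a step list
  `(r, s, a)`, `pivots`, `stTrim`, `deriveRun` (new relations from old), and the SOUNDNESS THEOREM `lcEval_eq_zero_of_elimRun`:
  if every relation evaluates to `0`, no multiplier vanishes and `lcIsZero (elimRun rels st E) = true`, then `Σ_i E[i]·T_i = 0`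
  (`lcEval_elimRun`: the run evaluates to `(∏ multipliers)·(value of E)`).
The symbolic run is too slow for the kernel on real data; `Certificates/PolyReflectPack.lean` runs it on packed integers.
No mathematics specific to ζ(5) lives here.
-/

namespace Summit.KontsevichZagierPeriods.Zeta5Search.PolyReflect

/-! ### Formal linear combinations of opaque symbols -/

/-- A formal linear combination `Σ_i E[i]·T_i`: entry `i` is the polynomial coefficient of the symbol `T_i`. -/
abbrev LC := List Poly3

/-- Evaluation `Σ_i ev3 E[i] · T (i₀ + i)` against symbol values `T : ℕ → ℚ`, starting at index `i₀`. -/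
def lcEval (T : ℕ → ℚ) (w x k : ℚ) : ℕ → LC → ℚ
  | _, [] => 0
  | i, c :: E => ev3 c w x k * T i + lcEval T w x k (i + 1) E

/-- Sum. -/
def lcAdd : LC → LC → LC
  | [], F => F
  | E, [] => E
  | a :: E, b :: F => add3 a b :: lcAdd E F

/-- Multiplication by a polynomial. -/
def lcSmul (a : Poly3) : LC → LC
  | [] => []
  | c :: E => mul3 a c :: lcSmul a E

/-- The coefficient of symbol `i` (`[]` past the end). -/
def lcGet : LC → ℕ → Poly3
  | [], _ => []
  | c :: _, 0 => c
  | _ :: E, i + 1 => lcGet E i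

/-- The combination `c·T_s` (as a list of length `s+1`). -/
def lcSingle : ℕ → Poly3 → LC
  | 0, c => [c]
  | s + 1, c => [] :: lcSingle s c

/-- A three-point relation instance `c₀·T_{s₀} + c₁·T_{s₁} + c₂·T_{s₂}`. -/
def rel3 (s₀ : ℕ) (c₀ : Poly3) (s₁ : ℕ) (c₁ : Poly3) (s₂ : ℕ) (c₂ : Poly3) : LC :=
  lcAdd (lcAdd (lcSingle s₀ c₀) (lcSingle s₁ c₁)) (lcSingle s₂ c₂)

/-- All coefficients vanish. -/
def lcIsZero : LC → Bool
  | [] => true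
  | c :: E => isZero3 c && lcIsZero E

/-- `lcEval` of `[]`. -/
@[simp] theorem lcEval_nil (T : ℕ → ℚ) (w x k : ℚ) (i : ℕ) : lcEval T w x k i [] = 0 := rfl
/-- `lcEval` of a cons. -/
@[simp] theorem lcEval_cons (T : ℕ → ℚ) (w x k : ℚ) (i : ℕ) (c : Poly3) (E : LC) :
    lcEval T w x k i (c :: E) = ev3 c w x k * T i + lcEval T w x k (i + 1) E := rfl

/-- `lcEval` is additive. -/
theorem lcEval_lcAdd (T : ℕ → ℚ) (w x k : ℚ) :
    ∀ (E F : LC) (i : ℕ), lcEval T w x k i (lcAdd E F) = lcEval T w x k i E + lcEval T w x k i F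
  | [], F, i => by simp [lcAdd]
  | a :: E, [], i => by simp [lcAdd]
  | a :: E, b :: F, i => by simp only [lcAdd, lcEval_cons, ev3_add3, lcEval_lcAdd T w x k E F (i + 1)]; ring

/-- `lcEval` of a polynomial multiple. -/
theorem lcEval_lcSmul (T : ℕ → ℚ) (w x k : ℚ) (a : Poly3) :
    ∀ (E : LC) (i : ℕ), lcEval T w x k i (lcSmul a E) = ev3 a w x k * lcEval T w x k i E
  | [], i => by simp [lcSmul]
  | c :: E, i => by simp only [lcSmul, lcEval_cons, ev3_mul3, lcEval_lcSmul T w x k a E (i + 1)]; ring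

/-- `lcEval` of a single term. -/
theorem lcEval_lcSingle (T : ℕ → ℚ) (w x k : ℚ) (c : Poly3) :
    ∀ (s i : ℕ), lcEval T w x k i (lcSingle s c) = ev3 c w x k * T (i + s)
  | 0, i => by simp [lcSingle]
  | s + 1, i => by
    simp only [lcSingle, lcEval_cons, ev3_nil, zero_mul, zero_add, lcEval_lcSingle T w x k c s (i + 1)]
    rw [show i + 1 + s = i + (s + 1) by ring]

/-- `lcEval` of a three-point relation instance. -/
theorem lcEval_rel3 (T : ℕ → ℚ) (w x k : ℚ) (s₀ : ℕ) (c₀ : Poly3) (s₁ : ℕ) (c₁ : Poly3) (s₂ : ℕ) (c₂ : Poly3) :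
    lcEval T w x k 0 (rel3 s₀ c₀ s₁ c₁ s₂ c₂) = ev3 c₀ w x k * T s₀ + ev3 c₁ w x k * T s₁ + ev3 c₂ w x k * T s₂ := by
  simp only [rel3, lcEval_lcAdd, lcEval_lcSingle, zero_add]

/-- Vanishing coefficients give the zero combination. -/
theorem lcEval_eq_zero_of_lcIsZero (T : ℕ → ℚ) (w x k : ℚ) :
    ∀ (E : LC) (i : ℕ), lcIsZero E = true → lcEval T w x k i E = 0
  | [], i, _ => rfl
  | c :: E, i, h => by
    simp only [lcIsZero, Bool.and_eq_true] at h
    simp [ev3_eq_zero_of_isZero3 c w x k h.1, lcEval_eq_zero_of_lcIsZero T w x k E (i + 1) h.2]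

/-- Trim every entry of a combination. -/
def lcTrim (E : LC) : LC := E.map trim3

/-- Trimming does not change the value of a combination. -/
theorem lcEval_lcTrim (T : ℕ → ℚ) (w x k : ℚ) : ∀ (E : LC) (i : ℕ), lcEval T w x k i (lcTrim E) = lcEval T w x k i E
  | [], i => rfl
  | c :: E, i => by
    have := lcEval_lcTrim T w x k E (i + 1)
    simp only [lcTrim, List.map_cons] at this ⊢
    simp [ev3_trim3, this]

/-! ### Fraction-free elimination and its soundness -/

/-- One elimination step with multiplier `a`, relation `R` and symbol `s`: `E ↦ a•E − E[s]•R`. With `a = R[s]` this kills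
the symbol `T_s`; soundness (below) holds for ANY `a`, so the multiplier is supplied by the certificate (as a readable
product of linear forms) rather than extracted from `R`. -/
def elimStep (a : Poly3) (R : LC) (s : ℕ) (E : LC) : LC :=
  lcAdd (lcSmul a E) (lcSmul (neg3 (lcGet E s)) R)

/-- A sequence of elimination steps `(r, s, a)`: use relation number `r` at symbol `s` with multiplier `a`. -/
def elimRun (rels : List LC) : List (ℕ × ℕ × Poly3) → LC → LC
  | [], E => E
  | (r, s, a) :: st, E => elimRun rels st (elimStep a (rels.getD r []) s E)

/-- The multipliers ("pivots") of a step sequence. -/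
def pivots (st : List (ℕ × ℕ × Poly3)) : List Poly3 := st.map fun t => t.2.2

/-- Trim the multipliers of a step sequence. -/
def stTrim (st : List (ℕ × ℕ × Poly3)) : List (ℕ × ℕ × Poly3) := st.map fun t => (t.1, t.2.1, trim3 t.2.2)

/-- Non-vanishing of the multipliers transfers to the trimmed step sequence. -/
theorem pivots_stTrim_ne_zero {st : List (ℕ × ℕ × Poly3)} {w x k : ℚ} (hp : ∀ p ∈ pivots st, ev3 p w x k ≠ 0) :
    ∀ p ∈ pivots (stTrim st), ev3 p w x k ≠ 0 := by
  intro p hpmem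
  simp only [pivots, stTrim, List.map_map, List.mem_map, Function.comp] at hpmem
  obtain ⟨t, ht, rfl⟩ := hpmem
  rw [ev3_trim3]
  exact hp t.2.2 (by simp only [pivots, List.mem_map]; exact ⟨t, ht, rfl⟩)

/-- Derived relations: each instruction `(r₁, r₂, s, a)` appends `elimStep a rels[r₂] s rels[r₁]` to the list. -/
def deriveRun : List LC → List (ℕ × ℕ × ℕ × Poly3) → List LC
  | rels, [] => rels
  | rels, (r₁, r₂, s, a) :: ds => deriveRun (rels ++ [elimStep a (rels.getD r₂ []) s (rels.getD r₁ [])]) ds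

/-- `lcEval` of an elimination step. -/
theorem lcEval_elimStep (T : ℕ → ℚ) (w x k : ℚ) (a : Poly3) (R : LC) (s : ℕ) (E : LC) :
    lcEval T w x k 0 (elimStep a R s E) =
      ev3 a w x k * lcEval T w x k 0 E - ev3 (lcGet E s) w x k * lcEval T w x k 0 R := by
  rw [elimStep, lcEval_lcAdd, lcEval_lcSmul, lcEval_lcSmul, ev3_neg3]; ring

/-- `getD` of a relation list all of whose members evaluate to zero evaluates to zero. -/
theorem lcEval_getD_eq_zero {T : ℕ → ℚ} {w x k : ℚ} {rels : List LC} (h : ∀ R ∈ rels, lcEval T w x k 0 R = 0)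
    (r : ℕ) : lcEval T w x k 0 (rels.getD r []) = 0 := by
  rw [List.getD_eq_getElem?_getD]
  cases hr : rels[r]? with
  | none => simp
  | some R => simpa using h R (List.mem_of_getElem? hr)

/-- **Soundness of elimination**: the result evaluates to `(∏ pivots) · (value of E)`. -/
theorem lcEval_elimRun (T : ℕ → ℚ) (w x k : ℚ) (rels : List LC) (h : ∀ R ∈ rels, lcEval T w x k 0 R = 0) :
    ∀ (st : List (ℕ × ℕ × Poly3)) (E : LC), lcEval T w x k 0 (elimRun rels st E) =
      ((pivots st).map fun p => ev3 p w x k).prod * lcEval T w x k 0 E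
  | [], E => by simp [elimRun, pivots]
  | (r, s, a) :: st, E => by
    rw [elimRun, lcEval_elimRun T w x k rels h st, lcEval_elimStep, lcEval_getD_eq_zero h r]
    simp [pivots]; ring

/-- Appending an elimination step between two relations keeps all relations zero. -/
theorem forall_lcEval_append_elimStep {T : ℕ → ℚ} {w x k : ℚ} {rels : List LC}
    (h : ∀ R ∈ rels, lcEval T w x k 0 R = 0) (r₁ r₂ s : ℕ) (a : Poly3) :
    ∀ R ∈ rels ++ [elimStep a (rels.getD r₂ []) s (rels.getD r₁ [])], lcEval T w x k 0 R = 0 := by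
  intro R hR
  rcases List.mem_append.1 hR with hR | hR
  · exact h R hR
  · simp only [List.mem_singleton] at hR
    rw [hR, lcEval_elimStep, lcEval_getD_eq_zero h r₁, lcEval_getD_eq_zero h r₂]; ring

/-- Derived relations evaluate to zero. -/
theorem forall_lcEval_deriveRun {T : ℕ → ℚ} {w x k : ℚ} :
    ∀ (ds : List (ℕ × ℕ × ℕ × Poly3)) (rels : List LC) (_ : ∀ R ∈ rels, lcEval T w x k 0 R = 0),
      ∀ R ∈ deriveRun rels ds, lcEval T w x k 0 R = 0
  | [], rels, h => fun R hR => h R (by simpa [deriveRun] using hR)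
  | (r₁, r₂, s, a) :: ds, rels, h => fun R hR => by
    simp only [deriveRun] at hR
    exact forall_lcEval_deriveRun ds _ (forall_lcEval_append_elimStep h r₁ r₂ s a) R hR

/-- **Module reduction by the kernel**: if every relation evaluates to `0`, no pivot vanishes, and the kernel computes
`lcIsZero (elimRun rels st E) = true`, then the combination `E` evaluates to `0`. (For large data use the packed form
`PolyReflectPack.lcEval_eq_zero_of_packedRun`; the symbolic computation is slow in the kernel.) -/
theorem lcEval_eq_zero_of_elimRun (T : ℕ → ℚ) (w x k : ℚ) (rels : List LC) (st : List (ℕ × ℕ × Poly3)) (E : LC)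
    (h : ∀ R ∈ rels, lcEval T w x k 0 R = 0) (hz : lcIsZero (elimRun rels st E) = true)
    (hp : ∀ p ∈ pivots st, ev3 p w x k ≠ 0) : lcEval T w x k 0 E = 0 := by
  have h1 := lcEval_elimRun T w x k rels h st E
  rw [lcEval_eq_zero_of_lcIsZero T w x k _ 0 hz] at h1
  have hprod : ((pivots st).map fun p => ev3 p w x k).prod ≠ 0 :=
    List.prod_ne_zero fun h0 => by
      obtain ⟨p, hpmem, hp0⟩ := List.mem_map.1 h0
      exact hp p hpmem hp0
  exact (mul_eq_zero.1 h1.symm).resolve_left hprod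

end Summit.KontsevichZagierPeriods.Zeta5Search.PolyReflect
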